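import Literature.Topology.FourManifolds.PlumbingHomology
import Literature.Topology.FourManifolds.RegularSlabOfProper
import Literature.AlgebraicTopology.FundamentalGroupoid.LevelSetSimplyConnected
import Literature.AlgebraicTopology.FundamentalGroupoid.CompactRetractionsSimplyConnected
import HarnessLib

/-!
# `π₁(∂M(4m)) = 1` reduced to the punctured interior `{0 < ρ < ε₀}` of the plumbing

Topic `Literature/Topology/FourManifolds` (fact seat of
`Literature.Topology.FourManifolds.HomotopySphere.exists_intersectionForm_equivalent_e8Form`,
Kosinski's `E₈` plumbing `M(4m)`, *Differential Manifolds* (1993), VI.12). Kosinski VI.(12.1):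
"if `k > 2` then `∂B` is simply connected". In the tree's model the boundary of the compact
plumbing `W = M(4m) = {ρ ≤ ε}` (`Plumbing.Wc`, `PlumbingFunction.lean`) is the level `{ρ = ε}` of
the size function on the open plumbing `PV`, every positive level being regular
(`Plumbing.isRegularLevel_rho`) and every `{ρ ≤ ε'}`, `ε' ≤ ε₀`, compact
(`Plumbing.isCompact_rho_le`). By Milnor's retractions (J. Milnor, *Morse theory* (1963),
Thm. 3.1: the region between two regular levels without critical values is a product; tree:
`RegularSlabOfProper.lean`) the level `{ρ = ε}`, `0 < ε < ε₀`, is simply connected as soon as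
the OPEN set `{0 < ρ < ε₀}` is (Hatcher 2002, Prop. 1.17, with the compactness of `I`, `I × I`;
tree: `CompactRetractionsSimplyConnected.lean`, `LevelSetSimplyConnected.lean`). This file
records that reduction for the tree's `W`:

* `Plumbing.isProperRegularSlab_rho` — `ρ⁻¹[a, b]`, `0 < a < b ≤ ε₀`, is a compact slab without
  critical points;
* `Plumbing.isSimplyConnected_pos_le_of_isSimplyConnected_pos_lt` — `{0 < ρ ≤ ε}` is simply
  connected if `{0 < ρ < ε₀}` is (`ε < ε₀`);
* `Plumbing.isSimplyConnected_level_of_isSimplyConnected_pos_lt` — so is the level `{ρ = ε}`;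
* **`Plumbing.simplyConnectedSpace_bd_of_isSimplyConnected_pos_lt`** — and hence the boundary
  `∂M(4m)` (the carrier of `Plumbing.Wc.bd`, homeomorphic to the level).

What is left for `π₁(∂M(4m)) = 1` is `π₁({0 < ρ < ε₀}) = 1`, a statement about an open subset
of the open plumbing (general position against the cores and the corner regions near the seven
crossing points, Kosinski VI.(12.1), `k > 2`). Everything is proved; no definitions, no named
facts (D-0026).

## References

* A. Kosinski, *Differential Manifolds*, Academic Press 1993, VI.12, (12.1). [Kosinski1993]
* J. Milnor, *Morse theory*, Ann. of Math. Studies 51 (1963), §3 Thm. 3.1. [Milnor1963]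
* A. Hatcher, *Algebraic Topology*, CUP 2002, Prop. 1.17. [HatcherAT2002]
-/

open scoped Manifold ContDiff Topology
open Set Function Topology TopologicalSpace

noncomputable section

namespace Literature.Topology.FourManifolds

open Literature.AlgebraicTopology.FundamentalGroupoid

namespace Plumbing

variable {k n : ℕ} {c : ℝ} (hk : 2 ≤ k) (hc : IsParam c) (hkn : k + k = n + 1)

/-- **The slabs of the size function are compact and regular**: for `0 < a < b ≤ ε₀` the slab
`ρ⁻¹[a, b] ⊆ PV` is compact (it lies in `{ρ ≤ b}`) and contains no critical point of `ρ` (all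
positive levels are regular) — Milnor's hypothesis of Thm. 3.1 (1963).
[cite: Milnor1963, §3 Thm. 3.1] [cite: Kosinski1993, VI.12 pp. 119–122] -/
theorem isProperRegularSlab_rho {a b : ℝ} (ha : 0 < a) (hab : a < b) (hb : b ≤ epsMax c) :
    IsProperRegularSlab n (rho hk hc hkn) a b where
  contMDiff := contMDiff_rho hk hc hkn
  lt := hab
  isCompact := (isCompact_rho_le hk hc hkn hb).of_isClosed_subset
    (isClosed_Icc.preimage (continuous_rho hk hc hkn)) fun _ hp => hp.2
  not_isMCriticalPt := fun _ hz => not_isMCriticalPt_rho hk hc hkn (ha.trans_le hz.1) rfl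

/-- **`{0 < ρ ≤ ε}` is simply connected if `{0 < ρ < ε₀}` is** (`0 < ε < ε₀`): every compact
subset of `{0 < ρ < ε₀}` lies in some `{0 < ρ ≤ v}`, `ε < v < ε₀`, which retracts onto
`{0 < ρ ≤ ε}` by Milnor's retraction of the slab `ρ⁻¹[ε, v]` onto its bottom level pasted with
the identity (`IsProperRegularSlab.exists_retraction_sublevel`), so Hatcher's Prop. 1.17 in the
form `IsSimplyConnected.of_compact_retractions` applies. [cite: Milnor1963, §3 Thm. 3.1] [cite: HatcherAT2002, Prop. 1.17] -/
theorem isSimplyConnected_pos_le_of_isSimplyConnected_pos_lt {ε : ℝ} (hε : 0 < ε)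
    (hε' : ε < epsMax c)
    (hV : IsSimplyConnected {p : PV k c hk hc hkn | 0 < rho hk hc hkn p ∧ rho hk hc hkn p < epsMax c}) :
    IsSimplyConnected {p : PV k c hk hc hkn | 0 < rho hk hc hkn p ∧ rho hk hc hkn p ≤ ε} := by
  refine hV.of_compact_retractions (fun p hp => ⟨hp.1, lt_of_le_of_lt hp.2 hε'⟩) fun K hK hKV => ?_
  -- the maximum of `ρ` on `K` is `< ε₀`
  rcases K.eq_empty_or_nonempty with rfl | hKne
  · exact ⟨id, continuousOn_id, fun _ h => h.elim, fun _ h => h.elim⟩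
  obtain ⟨p₀, hp₀K, hmax⟩ := hK.exists_isMaxOn hKne (continuous_rho hk hc hkn).continuousOn
  have hvlt : rho hk hc hkn p₀ < epsMax c := (hKV hp₀K).2
  set v : ℝ := (max (rho hk hc hkn p₀) ε + epsMax c) / 2 with hv
  have hεv : ε < v := by
    have := le_max_right (rho hk hc hkn p₀) ε; rw [hv]; linarith
  have hvb : v < epsMax c := by
    have : max (rho hk hc hkn p₀) ε < epsMax c := max_lt hvlt hε'
    rw [hv]; linarith
  have hKv : ∀ p ∈ K, rho hk hc hkn p ≤ v := by
    intro p hp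
    have h1 : rho hk hc hkn p ≤ rho hk hc hkn p₀ := hmax hp
    have h2 := le_max_left (rho hk hc hkn p₀) ε
    linarith
  -- the slab `[ε/2, ε₀]` and its sublevel retraction onto `{0 < ρ ≤ ε}`
  have hslab := isProperRegularSlab_rho hk hc hkn (a := ε / 2) (b := epsMax c) (by linarith)
    (by linarith) le_rfl
  obtain ⟨r, hr, hrT, hrid⟩ := hslab.exists_retraction_sublevel (u := ε) (v := v) (c := 0)
    (by linarith) hεv hvb hε
  refine ⟨r, hr.mono fun p hp => ⟨(hKV hp).1, hKv p hp⟩, fun p hp => hrT ⟨(hKV hp).1, hKv p hp⟩,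
    fun p _ hpT => hrid p hpT.2⟩

/-- **The level `{ρ = ε}` is simply connected if `{0 < ρ < ε₀}` is** (`0 < ε < ε₀`): by the
previous lemma `{0 < ρ ≤ ε}` is simply connected, and every slab `{δ ≤ ρ ≤ ε}`, `0 < δ < ε`,
retracts onto the level (Milnor's retraction of `ρ⁻¹[δ/2, ε]` onto its top level,
`IsProperRegularSlab.exists_retraction_setOf`), so
`isSimplyConnected_level_of_slab_retractions` applies. [cite: Milnor1963, §3 Thm. 3.1] [cite: HatcherAT2002, Prop. 1.17] [cite: Kosinski1993, VI.(12.1)] -/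
theorem isSimplyConnected_level_of_isSimplyConnected_pos_lt {ε : ℝ} (hε : 0 < ε)
    (hε' : ε < epsMax c)
    (hV : IsSimplyConnected {p : PV k c hk hc hkn | 0 < rho hk hc hkn p ∧ rho hk hc hkn p < epsMax c}) :
    IsSimplyConnected {p : PV k c hk hc hkn | rho hk hc hkn p = ε} := by
  have hT := isSimplyConnected_pos_le_of_isSimplyConnected_pos_lt hk hc hkn hε hε' hV
  refine isSimplyConnected_level_of_slab_retractions ⟨rho hk hc hkn, continuous_rho hk hc hkn⟩ hT
    fun δ hδ0 hδε => ?_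
  have hslab := isProperRegularSlab_rho hk hc hkn (a := δ / 2) (b := ε) (by linarith) (by linarith)
    hε'.le
  exact hslab.exists_retraction_setOf (δ := δ) (by linarith) hδε

/-- **`π₁(∂M(4m)) = 1` reduced to the punctured interior**: for `0 < ε < ε₀`, if the open set
`{0 < ρ < ε₀} ⊆ PV` is simply connected then so is the boundary `∂M(4m)` of the compact
plumbing `{ρ ≤ ε}` — the carrier of `Plumbing.Wc.bd`, which is homeomorphic to the level
`{ρ = ε}` (`RegularSublevel.mem_boundary_iff`). This is the form in which Kosinski's VI.(12.1)
("`∂B` is simply connected if `k > 2`") enters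
`HomotopySphere.exists_intersectionForm_equivalent_e8Form_of_plumbing`.
[cite: Kosinski1993, VI.(12.1)] [cite: Milnor1963, §3 Thm. 3.1] [cite: HatcherAT2002, Prop. 1.17] -/
theorem simplyConnectedSpace_bd_of_isSimplyConnected_pos_lt {ε : ℝ} (hε : 0 < ε)
    (hε' : ε < epsMax c)
    (hV : IsSimplyConnected {p : PV k c hk hc hkn | 0 < rho hk hc hkn p ∧ rho hk hc hkn p < epsMax c}) :
    SimplyConnectedSpace (Wc.bd hk hc hkn hε).carrier := by
  have hL := isSimplyConnected_level_of_isSimplyConnected_pos_lt hk hc hkn hε hε' hV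
  haveI : SimplyConnectedSpace ↥{p : PV k c hk hc hkn | rho hk hc hkn p = ε} := hL
  -- the boundary carrier is homeomorphic to the level
  let Φ : (Wc.bd hk hc hkn hε).carrier ≃ₜ ↥{p : PV k c hk hc hkn | rho hk hc hkn p = ε} :=
    { toFun := fun z => ⟨(z.1 : Wc hk hc hkn hε).1, (RegularSublevel.mem_boundary_iff _ z.1).1 z.2⟩
      invFun := fun p => ⟨⟨p.1, le_of_eq p.2⟩, (RegularSublevel.mem_boundary_iff _ _).2 p.2⟩
      left_inv := fun _ => rfl
      right_inv := fun _ => rfl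
      continuous_toFun := by
        refine Continuous.subtype_mk ?_ _
        exact continuous_subtype_val.comp continuous_subtype_val
      continuous_invFun := by
        refine Continuous.subtype_mk (Continuous.subtype_mk continuous_subtype_val _) _ }
  exact Φ.toHomotopyEquiv.simplyConnectedSpace

end Plumbing

end Literature.Topology.FourManifolds
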